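import Literature.NumberTheory.LFunctions.RudnickSarnakSpread
import Literature.NumberTheory.LFunctions.RudnickSarnakDeterminant
import Literature.NumberTheory.LFunctions.RudnickSarnakStrata
import Mathlib.MeasureTheory.Measure.Lebesgue.Basic
import Mathlib.LinearAlgebra.Matrix.Block
import HarnessLib

/-!
# Rudnick–Sarnak Lemmas 4.2–4.3: the cube functional as an integral over the stratum

Z. Rudnick, P. Sarnak, Duke Math. J. **81** (1996), pp. 309–312. The cube functional
`I_σ(Φ) = ∫_{[-1/2,1/2]ⁿ} Φ(s ∘ σ - s) ds` of a permutation `σ` (`cubeFunctional`, the paired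
Fourier transform of the summand `sign σ ∏ K(x_i - x_{σ i})` of `W_n`) is computed cycle by
cycle: on each cycle `a → σa → ⋯ → σ^{ℓ-1} a → a` one has `s_{σ^p a} = s_a + ∑_{m<p} u_{σ^m a}`
for `u = s ∘ σ - s`, so that, `u` being fixed on the stratum
`H_G = {∑_{i ∈ C} u_i = 0 for every cycle C}` (`G` the orbit partition of `σ`), the variable
`s_a` ranges over an interval of length `1 - V` with `V` the spread of the partial sums
(**Lemma 4.3**: `∫ Ω(v) Ω(v + s₁) ⋯ Ω(v + s₁ + ⋯ + s_{m-1}) dv = 1 - V`, and Lemma 4.2 for the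
`δ(∑ u_i)`). The outcome is

* `cubeFunctional_eq_integral_extG` :
  `I_σ(Φ) = ∫_{H_G} Φ(u) ∏_{C} (1 - V_{σ,C}(u))₊ du`,

the integral over `H_G` being taken in the coordinates of `RudnickSarnakStrata.lean`
(`u = extG G u'`, `u'` the free coordinates, Lebesgue measure) and `V_{σ,C} = cycSpread` of
`RudnickSarnakSpread.lean`. The change of variables `s ↦ (s|_{representatives}, u|_{free})`
is linear with determinant `±1` (its matrix is triangular for a suitable order of the indices).

## References

* Z. Rudnick, P. Sarnak, Duke Math. J. 81 (1996), (4.19)–(4.21), Lemma 4.2, Lemma 4.3,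
  (4.27)–(4.32).
-/

noncomputable section

open Finset Equiv Equiv.Perm MeasureTheory
open Literature.Combinatorics.Enumerative Literature.Combinatorics.Enumerative.Spitzer
open scoped Classical

namespace Literature.NumberTheory.LFunctions

namespace RudnickSarnak

variable {n : ℕ} (σ : Perm (Fin n))

/-! ## Positions along the cycles of `σ` -/

/-- `σ` is cyclic on each block of its orbit partition. [folklore] -/
theorem isCycleOn_part (j : Fin n) : σ.IsCycleOn ((cyclePart σ).part j : Set (Fin n)) :=
  (mem_fib.1 (mem_fib_parts_iff.2 rfl)).1 _ ((cyclePart σ).part_mem.2 (mem_univ j))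

/-- `σ j` lies in the block of `j`. [folklore] -/
theorem apply_mem_part (j : Fin n) : σ j ∈ (cyclePart σ).part j :=
  mem_part_cyclePart.2 ((SameCycle.refl σ j).apply_right)

/-- The representative of the block of `σ j` is that of `j`. [folklore] -/
theorem rep_apply (j : Fin n) : rep (cyclePart σ) (σ j) = rep (cyclePart σ) j :=
  rep_eq_rep_of_mem _ (apply_mem_part σ j)

/-- [folklore] -/
theorem rep_pow_apply (m : ℕ) (j : Fin n) : rep (cyclePart σ) ((σ ^ m) j) = rep (cyclePart σ) j := by
  induction m with
  | zero => simp
  | succ m ih => rw [pow_succ', Perm.mul_apply, rep_apply, ih]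

/-- Some power of `σ` takes the representative to `j`. [folklore] -/
theorem exists_pow_rep_eq (j : Fin n) : ∃ m : ℕ, (σ ^ m) (rep (cyclePart σ) j) = j :=
  (mem_part_cyclePart.1 (rep_mem (cyclePart σ) j)).symm.exists_nat_pow_eq

/-- The position of `j` along its cycle, counted from the representative. [folklore] -/
def pos (j : Fin n) : ℕ := Nat.find (exists_pow_rep_eq σ j)

/-- [folklore] -/
theorem pow_pos_rep (j : Fin n) : (σ ^ pos σ j) (rep (cyclePart σ) j) = j :=
  Nat.find_spec (exists_pow_rep_eq σ j)

/-- [folklore] -/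
theorem pos_le_of_pow_eq {j : Fin n} {m : ℕ} (h : (σ ^ m) (rep (cyclePart σ) j) = j) :
    pos σ j ≤ m :=
  Nat.find_min' _ h

/-- The representative has position `0`, and only it. [folklore] -/
theorem pos_eq_zero_iff {j : Fin n} : pos σ j = 0 ↔ IsRep (cyclePart σ) j := by
  constructor
  · intro h
    have := pow_pos_rep σ j
    rw [h, pow_zero, Perm.one_apply] at this
    exact this
  · intro h
    have : (σ ^ 0) (rep (cyclePart σ) j) = j := by
      rw [pow_zero, Perm.one_apply]
      exact h
    exact Nat.le_zero.1 (pos_le_of_pow_eq σ this)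

/-- The position is less than the length of the cycle. [folklore] -/
theorem pos_lt_card (j : Fin n) : pos σ j < #((cyclePart σ).part j) := by
  obtain ⟨m, hm, hmj⟩ := (isCycleOn_part σ j).exists_pow_eq (rep_mem (cyclePart σ) j)
    ((cyclePart σ).mem_part_self.2 (mem_univ j))
  exact (pos_le_of_pow_eq σ hmj).trans_lt hm

/-- [folklore] -/
theorem pos_lt (j : Fin n) : pos σ j < n :=
  (pos_lt_card σ j).trans_le ((card_le_univ _).trans_eq (Fintype.card_fin n))

/-- Along a cycle the position increases by one, until the cycle closes up at the
representative. [folklore] -/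
theorem pos_apply_of_not_isRep {j : Fin n} (hj : ¬IsRep (cyclePart σ) (σ j)) :
    pos σ (σ j) = pos σ j + 1 := by
  refine le_antisymm (pos_le_of_pow_eq σ ?_) ?_
  · rw [rep_apply, pow_succ', Perm.mul_apply, pow_pos_rep]
  · have hq : pos σ (σ j) ≠ 0 := fun h ↦ hj ((pos_eq_zero_iff σ).1 h)
    obtain ⟨q, hq'⟩ : ∃ q, pos σ (σ j) = q + 1 := Nat.exists_eq_succ_of_ne_zero hq
    have h1 := pow_pos_rep σ (σ j)
    rw [hq', rep_apply, pow_succ', Perm.mul_apply] at h1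
    have h2 : (σ ^ q) (rep (cyclePart σ) j) = j := σ.injective h1
    have := pos_le_of_pow_eq σ h2
    omega

/-- A free index is moved by `σ`. [folklore] -/
theorem apply_ne_of_not_isRep {j : Fin n} (hj : ¬IsRep (cyclePart σ) j) : σ j ≠ j := by
  intro h
  apply hj
  obtain ⟨m, hm⟩ := (mem_part_cyclePart.1 (rep_mem (cyclePart σ) j)).exists_nat_pow_eq
  have hfix : ∀ m : ℕ, (σ ^ m) j = j := by
    intro m
    induction m with
    | zero => simp
    | succ m ih => rw [pow_succ', Perm.mul_apply, ih, h]
  rw [hfix] at hm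
  show rep (cyclePart σ) j = j
  exact hm.symm

/-! ## The change of variables -/

/-- The change of variables `T`: representatives keep their coordinate `s_a`, a free index `j`
gets the difference `u_j = s_{σ j} - s_j`. [cite: RudnickSarnak1996, Lemma 4.2] -/
def cubeChange (s : Fin n → ℝ) (j : Fin n) : ℝ :=
  if IsRep (cyclePart σ) j then s j else s (σ j) - s j

/-- `T` as a linear map. [cite: RudnickSarnak1996, Lemma 4.2] -/
def cubeChangeLin : (Fin n → ℝ) →ₗ[ℝ] (Fin n → ℝ) where
  toFun := cubeChange σ
  map_add' s t := by
    funext j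
    simp only [cubeChange, Pi.add_apply]
    split_ifs <;> ring
  map_smul' c s := by
    funext j
    simp only [cubeChange, Pi.smul_apply, smul_eq_mul, RingHom.id_apply]
    split_ifs <;> ring

/-- [folklore] -/
theorem cubeChangeLin_apply (s : Fin n → ℝ) : cubeChangeLin σ s = cubeChange σ s := rfl

/-- The triangularity key: representatives last, free indices by position; refined by the index
to make it injective. [folklore] -/
def triKey (i : Fin n) : ℕ := (if IsRep (cyclePart σ) i then n else pos σ i) * n + i

/-- [folklore] -/
theorem triKey_injective : Function.Injective (triKey σ) := by
  intro i j h
  simp only [triKey] at h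
  have hi := i.isLt
  have hj := j.isLt
  have : (i : ℕ) = j := by
    have h1 : ((if IsRep (cyclePart σ) i then n else pos σ i) * n + i) % n = (i : ℕ) % n := by
      rw [Nat.mul_add_mod']
    have h2 : ((if IsRep (cyclePart σ) j then n else pos σ j) * n + j) % n = (j : ℕ) % n := by
      rw [Nat.mul_add_mod']
    rw [h] at h1
    rw [h1, Nat.mod_eq_of_lt hi, Nat.mod_eq_of_lt hj] at h2
    exact h2
  exact Fin.ext this

/-- For a free index `j`, `σ j` has a larger key. [folklore] -/
theorem triKey_lt_triKey_apply {j : Fin n} (hj : ¬IsRep (cyclePart σ) j) :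
    triKey σ j < triKey σ (σ j) := by
  simp only [triKey, hj, ↓reduceIte]
  have hpj := pos_lt σ j
  by_cases h : IsRep (cyclePart σ) (σ j)
  · simp only [h, ↓reduceIte]
    have hj' := j.isLt
    nlinarith
  · simp only [h, ↓reduceIte]
    rw [pos_apply_of_not_isRep σ h]
    have hj' := j.isLt
    nlinarith

/-- The matrix of `T`. [folklore] -/
theorem toMatrix_cubeChangeLin_apply (i j : Fin n) :
    LinearMap.toMatrix' (cubeChangeLin σ) i j =
      if IsRep (cyclePart σ) i then (if i = j then 1 else 0)
      else (if σ i = j then 1 else 0) - (if i = j then 1 else 0) := by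
  rw [LinearMap.toMatrix'_apply, cubeChangeLin_apply, cubeChange]
  simp only [Pi.single_apply]

/-- The matrix of `T` is triangular for the key order. [folklore] -/
theorem blockTriangular_cubeChangeLin :
    (LinearMap.toMatrix' (cubeChangeLin σ)).BlockTriangular (triKey σ) := by
  intro i j hij
  rw [toMatrix_cubeChangeLin_apply]
  have hne : i ≠ j := fun h ↦ by rw [h] at hij; exact lt_irrefl _ hij
  by_cases hi : IsRep (cyclePart σ) i
  · simp [hi, hne]
  · have hne' : σ i ≠ j := by
      intro h
      rw [← h] at hij
      exact lt_asymm hij (triKey_lt_triKey_apply σ hi)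
    simp [hi, hne, hne']

/-- The diagonal of the matrix of `T`: `1` at representatives, `-1` at free indices. [folklore] -/
theorem toMatrix_cubeChangeLin_diag (i : Fin n) :
    LinearMap.toMatrix' (cubeChangeLin σ) i i = if IsRep (cyclePart σ) i then 1 else -1 := by
  rw [toMatrix_cubeChangeLin_apply]
  by_cases hi : IsRep (cyclePart σ) i
  · simp [hi]
  · simp [hi, apply_ne_of_not_isRep σ hi]

/-- **`|det T| = 1`.** [cite: RudnickSarnak1996, Lemma 4.2] -/
theorem abs_det_cubeChangeLin : |LinearMap.det (cubeChangeLin σ)| = 1 := by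
  rw [← LinearMap.det_toMatrix', (blockTriangular_cubeChangeLin σ).det]
  rw [Finset.abs_prod]
  refine Finset.prod_eq_one fun a ha ↦ ?_
  obtain ⟨i, -, rfl⟩ := Finset.mem_image.1 ha
  have hcard : Fintype.card {j : Fin n // triKey σ j = triKey σ i} = 1 := by
    rw [Fintype.card_eq_one_iff]
    refine ⟨⟨i, rfl⟩, fun ⟨j, hj⟩ ↦ Subtype.ext (triKey_injective σ hj)⟩
  rw [Matrix.det_eq_elem_of_card_eq_one hcard ⟨i, rfl⟩]
  simp only [Matrix.toSquareBlock_def, Matrix.of_apply]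
  rw [toMatrix_cubeChangeLin_diag]
  split_ifs <;> simp

/-- `det T ≠ 0`. [folklore] -/
theorem det_cubeChangeLin_ne_zero : LinearMap.det (cubeChangeLin σ) ≠ 0 := by
  intro h
  have := abs_det_cubeChangeLin σ
  rw [h, abs_zero] at this
  exact zero_ne_one this

/-- **`T` preserves Lebesgue measure.** [cite: RudnickSarnak1996, Lemma 4.2] -/
theorem measurePreserving_cubeChangeLin :
    MeasurePreserving (cubeChangeLin σ) (volume : Measure (Fin n → ℝ)) volume := by
  refine ⟨(cubeChangeLin σ).continuous_of_finiteDimensional.measurable, ?_⟩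
  rw [Real.map_linearMap_volume_pi_eq_smul_volume_pi (det_cubeChangeLin_ne_zero σ), abs_inv,
    abs_det_cubeChangeLin σ]
  simp

/-- `T` as a linear equivalence. [folklore] -/
def cubeChangeEquiv : (Fin n → ℝ) ≃ₗ[ℝ] (Fin n → ℝ) :=
  LinearMap.equivOfDetNeZero (cubeChangeLin σ) (det_cubeChangeLin_ne_zero σ)

/-- [folklore] -/
theorem cubeChangeEquiv_apply (s : Fin n → ℝ) : cubeChangeEquiv σ s = cubeChange σ s := rfl

/-- `T` is a measurable embedding. [folklore] -/
theorem measurableEmbedding_cubeChange : MeasurableEmbedding (cubeChangeLin σ) :=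
  (cubeChangeEquiv σ).toContinuousLinearEquiv.toHomeomorph.measurableEmbedding


/-! ## Partial sums along the cycles -/

/-- Telescoping along a cycle: `s(σ^m a) = s(a) + ∑_{i<m} (s(σ^{i+1} a) - s(σ^i a))`.
[cite: RudnickSarnak1996, Lemma 4.2] -/
theorem apply_pow_eq_add_sum (s : Fin n → ℝ) (a : Fin n) (m : ℕ) :
    s ((σ ^ m) a) = s a + ∑ i ∈ range m, (s (σ ((σ ^ i) a)) - s ((σ ^ i) a)) := by
  induction m with
  | zero => simp
  | succ m ih =>
    rw [Finset.sum_range_succ, ← add_assoc, ← ih, pow_succ', Perm.mul_apply]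
    ring

/-- The partial sum of `u` along the cycle of `j`, from the representative up to (excluding)
`j`: `c_j(u) = ∑_{i < pos j} u(σ^i a)`, `a = rep j` (RS (4.29): the consecutive partial sums
`s_k(O)`). [cite: RudnickSarnak1996, (4.29)] -/
def cycSum (u : Fin n → ℝ) (j : Fin n) : ℝ :=
  ∑ i ∈ range (pos σ j), u ((σ ^ i) (rep (cyclePart σ) j))

/-- The block sums of `s ∘ σ - s` vanish. [cite: RudnickSarnak1996, Lemma 4.2] -/
theorem sum_part_sub_eq_zero (s : Fin n → ℝ) (j : Fin n) :
    ∑ i ∈ (cyclePart σ).part j, (s (σ i) - s i) = 0 := by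
  rw [Finset.sum_sub_distrib, sub_eq_zero]
  have hC := isCycleOn_part σ j
  have hC' : σ⁻¹.IsCycleOn ((cyclePart σ).part j : Set (Fin n)) := isCycleOn_inv.2 hC
  refine Finset.sum_nbij' (fun i ↦ σ i) (fun i ↦ σ⁻¹ i) (fun i hi ↦ IsCycleOn.apply_mem' hC hi)
    (fun i hi ↦ IsCycleOn.apply_mem' hC' hi) (fun i _ ↦ by simp) (fun i _ ↦ by simp) (fun _ _ ↦ rfl)

/-- `s ∘ σ - s` is `extG` of its free coordinates. [folklore] -/
theorem extG_sub_eq (s : Fin n → ℝ) :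
    extG (cyclePart σ) (fun i : Free (cyclePart σ) ↦ s (σ i) - s i) = fun j ↦ s (σ j) - s j :=
  extG_eq_of_sum_part_eq_zero _ _ (sum_part_sub_eq_zero σ s)

/-! ## Inverting the change of variables -/

/-- If `T s = w` then the differences `s ∘ σ - s` are `extG` of the free coordinates of `w`.
[cite: RudnickSarnak1996, Lemma 4.2] -/
theorem sub_eq_extG_of_cubeChange_eq {s w : Fin n → ℝ} (h : cubeChange σ s = w) :
    (fun j ↦ s (σ j) - s j) = extG (cyclePart σ) (fun i : Free (cyclePart σ) ↦ w i) := by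
  rw [← extG_sub_eq]
  congr 1
  funext i
  have := congrFun h i
  simp only [cubeChange, i.2, ↓reduceIte] at this
  exact this

/-- If `T s = w` then `s_j = w_{rep j} + c_j(u)`, `u = s ∘ σ - s`. [cite: RudnickSarnak1996, Lemma 4.2] -/
theorem apply_eq_of_cubeChange_eq {s w : Fin n → ℝ} (h : cubeChange σ s = w) (j : Fin n) :
    s j = w (rep (cyclePart σ) j) + cycSum σ (fun j ↦ s (σ j) - s j) j := by
  have h1 := apply_pow_eq_add_sum σ s (rep (cyclePart σ) j) (pos σ j)
  rw [pow_pos_rep] at h1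
  rw [h1, cycSum]
  congr 1
  have := congrFun h (rep (cyclePart σ) j)
  simp only [cubeChange, isRep_rep, ↓reduceIte] at this
  exact this

/-- The box condition on the representative coordinates `t`, for given free coordinates `u'`:
every `t_{rep j} + c_j(extG u')` lies in `[-1/2, 1/2]`. [cite: RudnickSarnak1996, Lemma 4.3] -/
def InBox (u' : Free (cyclePart σ) → ℝ) (t : {j : Fin n // IsRep (cyclePart σ) j} → ℝ) : Prop :=
  ∀ j : Fin n, t ⟨rep (cyclePart σ) j, isRep_rep _ j⟩ + cycSum σ (extG (cyclePart σ) u') j ∈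
    Set.Icc (-1 / 2 : ℝ) (1 / 2)

/-- The transported integrand: in the variables `w = T s`, the integrand
`𝟙_{cube}(s) Φ(s ∘ σ - s)` reads `𝟙[InBox] Φ(extG(w|_{free}))`. [cite: RudnickSarnak1996, Lemma 4.2] -/
theorem indicator_comp_symm_apply (Φ : (Fin n → ℝ) → ℂ) (w : Fin n → ℝ) :
    (rsCube n).indicator (fun s ↦ Φ (fun j ↦ s (σ j) - s j)) ((cubeChangeEquiv σ).symm w) =
      if InBox σ (fun i : Free (cyclePart σ) ↦ w i) (fun r ↦ w r) then
        Φ (extG (cyclePart σ) (fun i : Free (cyclePart σ) ↦ w i)) else 0 := by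
  set s := (cubeChangeEquiv σ).symm w with hs
  have h : cubeChange σ s = w := by
    rw [← cubeChangeEquiv_apply, hs, LinearEquiv.apply_symm_apply]
  have hu := sub_eq_extG_of_cubeChange_eq σ h
  have hmem : s ∈ rsCube n ↔ InBox σ (fun i : Free (cyclePart σ) ↦ w i) (fun r ↦ w r) := by
    simp only [rsCube, Set.mem_univ_pi, InBox]
    refine forall_congr' fun j ↦ ?_
    rw [apply_eq_of_cubeChange_eq σ h j, hu]
  by_cases hbox : InBox σ (fun i : Free (cyclePart σ) ↦ w i) (fun r ↦ w r)
  · rw [Set.indicator_of_mem (hmem.2 hbox), if_pos hbox, hu]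
  · rw [Set.indicator_of_notMem (fun h' ↦ hbox (hmem.1 h')), if_neg hbox]

/-- **The cube functional after the change of variables.** [cite: RudnickSarnak1996, Lemma 4.2] -/
theorem cubeFunctional_eq_integral_cubeChange (Φ : (Fin n → ℝ) → ℂ) :
    cubeFunctional σ Φ = ∫ w : Fin n → ℝ,
      if InBox σ (fun i : Free (cyclePart σ) ↦ w i) (fun r ↦ w r) then
        Φ (extG (cyclePart σ) (fun i : Free (cyclePart σ) ↦ w i)) else 0 := by
  unfold cubeFunctional
  rw [← integral_indicator (measurableSet_rsCube n)]
  set F : (Fin n → ℝ) → ℂ := fun w ↦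
    (rsCube n).indicator (fun s ↦ Φ (fun j ↦ s (σ j) - s j)) ((cubeChangeEquiv σ).symm w) with hF
  have hcomp : ∀ s, F (cubeChangeLin σ s) = (rsCube n).indicator (fun s ↦ Φ (fun j ↦ s (σ j) - s j)) s := by
    intro s
    simp only [hF]
    congr 1
    exact (cubeChangeEquiv σ).symm_apply_apply s
  simp_rw [← hcomp]
  rw [(measurePreserving_cubeChangeLin σ).integral_comp (measurableEmbedding_cubeChange σ) F]
  refine integral_congr_ae (Filter.Eventually.of_forall fun w ↦ ?_)
  exact indicator_comp_symm_apply σ Φ w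


/-! ## Integrating out the representative coordinates (Lemma 4.3) -/

/-- Membership in the block of a representative. [folklore] -/
theorem mem_part_iff_rep_eq (G : Finpartition (univ : Finset (Fin n))) {r : Fin n} (hr : IsRep G r)
    {j : Fin n} : j ∈ G.part r ↔ rep G j = r := by
  constructor
  · intro h
    rw [rep_eq_rep_of_mem G h]
    exact hr
  · intro h
    rw [← h, part_rep]
    exact G.mem_part_self.2 (mem_univ j)

/-- The interval of admissible values of the representative coordinate `s_r`, given the
partial sums: `I_r(u) = {x : x + c_j(u) ∈ [-1/2, 1/2] for all j in the block of r}` (the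
intersection of the intervals `I - s_k` of RS's proof of Lemma 4.3). [cite: RudnickSarnak1996, Lemma 4.3] -/
def repInterval (u : Fin n → ℝ) (r : Fin n) : Set ℝ :=
  {x | ∀ j ∈ (cyclePart σ).part r, x + cycSum σ u j ∈ Set.Icc (-1 / 2 : ℝ) (1 / 2)}

/-- [folklore] -/
theorem part_nonempty (r : Fin n) : ((cyclePart σ).part r).Nonempty :=
  ⟨r, (cyclePart σ).mem_part_self.2 (mem_univ r)⟩

/-- **RS Lemma 4.3, the interval**: `I_r(u) = [-1/2 - m, 1/2 - M]` with `M`, `m` the maximum and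
minimum of the partial sums over the block ("this intersection ... equals the interval
`[-m - 1/2, -M + 1/2]`", p. 312). [cite: RudnickSarnak1996, Lemma 4.3] -/
theorem repInterval_eq_Icc (u : Fin n → ℝ) (r : Fin n) :
    repInterval σ u r = Set.Icc
      (-1 / 2 - ((cyclePart σ).part r).inf' (part_nonempty σ r) (cycSum σ u))
      (1 / 2 - ((cyclePart σ).part r).sup' (part_nonempty σ r) (cycSum σ u)) := by
  ext x
  simp only [repInterval, Set.mem_setOf_eq, Set.mem_Icc]
  constructor
  · intro h
    obtain ⟨j₀, hj₀, h₀⟩ := Finset.exists_mem_eq_inf' (part_nonempty σ r) (cycSum σ u)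
    obtain ⟨j₁, hj₁, h₁⟩ := Finset.exists_mem_eq_sup' (part_nonempty σ r) (cycSum σ u)
    rw [h₀, h₁]
    have := h j₀ hj₀
    have := h j₁ hj₁
    constructor <;> linarith [(h j₀ hj₀).1, (h j₁ hj₁).2]
  · rintro ⟨hlo, hhi⟩ j hj
    have h1 := Finset.inf'_le (cycSum σ u) hj
    have h2 := Finset.le_sup' (cycSum σ u) hj
    constructor <;> linarith

/-- The length of `I_r(u)`: `(1 - (M - m))₊` (RS Lemma 4.3: "whose length is `1 - V`"; outside
`∑ |u_j| < 2` the positive part appears). [cite: RudnickSarnak1996, Lemma 4.3] -/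
def boxLen (u : Fin n → ℝ) (r : Fin n) : ℝ :=
  max (1 - (((cyclePart σ).part r).sup' (part_nonempty σ r) (cycSum σ u) -
    ((cyclePart σ).part r).inf' (part_nonempty σ r) (cycSum σ u))) 0

/-- `vol I_r(u) = (1 - (M - m))₊`. [cite: RudnickSarnak1996, Lemma 4.3] -/
theorem volume_real_repInterval (u : Fin n → ℝ) (r : Fin n) :
    (volume (repInterval σ u r)).toReal = boxLen σ u r := by
  rw [repInterval_eq_Icc, Real.volume_Icc, ENNReal.toReal_ofReal', boxLen]
  congr 1
  ring

/-- The box of admissible representative coordinates is the product of the intervals.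
[cite: RudnickSarnak1996, Lemma 4.3] -/
theorem setOf_inBox_eq_pi (u' : Free (cyclePart σ) → ℝ) :
    {t : {j : Fin n // IsRep (cyclePart σ) j} → ℝ | InBox σ u' t} =
      Set.pi Set.univ fun r : {j : Fin n // IsRep (cyclePart σ) j} ↦
        repInterval σ (extG (cyclePart σ) u') (r : Fin n) := by
  ext t
  simp only [Set.mem_setOf_eq, Set.mem_univ_pi, InBox, repInterval]
  constructor
  · intro h r j hj
    have hjr : rep (cyclePart σ) j = r := (mem_part_iff_rep_eq _ r.2).1 hj
    have : (⟨rep (cyclePart σ) j, isRep_rep _ j⟩ : {j : Fin n // IsRep (cyclePart σ) j}) = r :=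
      Subtype.ext hjr
    rw [← this]
    exact h j
  · intro h j
    exact h ⟨rep (cyclePart σ) j, isRep_rep _ j⟩ j
      ((mem_part_iff_rep_eq _ (isRep_rep _ j)).2 rfl)

/-- **RS Lemma 4.3**: integrating out the representative coordinates yields the product of the
interval lengths. [cite: RudnickSarnak1996, Lemma 4.3] -/
theorem integral_ite_inBox (u' : Free (cyclePart σ) → ℝ) (c : ℂ) :
    (∫ t : {j : Fin n // IsRep (cyclePart σ) j} → ℝ, if InBox σ u' t then c else 0) =
      ((∏ r : {j : Fin n // IsRep (cyclePart σ) j}, boxLen σ (extG (cyclePart σ) u') r : ℝ) : ℂ) * c := by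
  have hset := setOf_inBox_eq_pi σ u'
  have hmeas : MeasurableSet {t : {j : Fin n // IsRep (cyclePart σ) j} → ℝ | InBox σ u' t} := by
    rw [hset]
    exact MeasurableSet.univ_pi fun r ↦ by rw [repInterval_eq_Icc]; exact measurableSet_Icc
  have hind : (fun t : {j : Fin n // IsRep (cyclePart σ) j} → ℝ ↦ if InBox σ u' t then c else 0) =
      {t | InBox σ u' t}.indicator fun _ ↦ c := by
    funext t
    simp only [Set.indicator_apply, Set.mem_setOf_eq]
  rw [hind, integral_indicator_const c hmeas, Measure.real, hset, volume_pi_pi,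
    ENNReal.toReal_prod, Complex.real_smul]
  congr 2
  exact Finset.prod_congr rfl fun r _ ↦ volume_real_repInterval σ _ r

/-! ## The cube functional over the stratum -/

/-- `T` as a measurable equivalence. [folklore] -/
def cubeChangeMEquiv : (Fin n → ℝ) ≃ᵐ (Fin n → ℝ) :=
  (cubeChangeEquiv σ).toContinuousLinearEquiv.toHomeomorph.toMeasurableEquiv

/-- [folklore] -/
theorem cubeChangeMEquiv_apply (s : Fin n → ℝ) : cubeChangeMEquiv σ s = cubeChange σ s := rfl

/-- [folklore] -/
theorem measurePreserving_cubeChangeMEquiv :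
    MeasurePreserving (cubeChangeMEquiv σ) (volume : Measure (Fin n → ℝ)) volume :=
  measurePreserving_cubeChangeLin σ

/-- The transported integrand is integrable (for continuous `Φ`). [folklore] -/
theorem integrable_ite_inBox {Φ : (Fin n → ℝ) → ℂ} (hΦ : Continuous Φ) :
    Integrable (fun w : Fin n → ℝ ↦
      if InBox σ (fun i : Free (cyclePart σ) ↦ w i) (fun r ↦ w r) then
        Φ (extG (cyclePart σ) (fun i : Free (cyclePart σ) ↦ w i)) else 0) := by
  have hG : Integrable ((rsCube n).indicator fun s : Fin n → ℝ ↦ Φ (fun j ↦ s (σ j) - s j)) := by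
    rw [integrable_indicator_iff (measurableSet_rsCube n)]
    refine ContinuousOn.integrableOn_compact (isCompact_univ_pi fun _ ↦ isCompact_Icc) ?_
    refine (hΦ.comp ?_).continuousOn
    exact continuous_pi fun j ↦ ((continuous_apply (σ j)).sub (continuous_apply j))
  have h := ((measurePreserving_cubeChangeMEquiv σ).symm _).integrable_comp_emb
    (cubeChangeMEquiv σ).symm.measurableEmbedding (g := (rsCube n).indicator fun s : Fin n → ℝ ↦
      Φ (fun j ↦ s (σ j) - s j)) |>.2 hG
  refine h.congr (Filter.Eventually.of_forall fun w ↦ ?_)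
  exact indicator_comp_symm_apply σ Φ w

/-- **The cube functional as an integral over the stratum `H_G`** (RS Lemma 4.2 with
Lemma 4.3, in the coordinates of `RudnickSarnakStrata.lean`): for continuous `Φ`,
`∫_{[-1/2,1/2]ⁿ} Φ(s ∘ σ - s) ds = ∫ ∏_r (1 - (M_r - m_r))₊ · Φ(extG u') du'`, the product over
the cycles (through their representatives `r`) of the lengths of the intervals of Lemma 4.3.
[cite: RudnickSarnak1996, Lemma 4.2 and Lemma 4.3] -/
theorem cubeFunctional_eq_integral_boxLen {Φ : (Fin n → ℝ) → ℂ} (hΦ : Continuous Φ) :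
    cubeFunctional σ Φ = ∫ u' : Free (cyclePart σ) → ℝ,
      ((∏ r : {j : Fin n // IsRep (cyclePart σ) j}, boxLen σ (extG (cyclePart σ) u') r : ℝ) : ℂ) *
        Φ (extG (cyclePart σ) u') := by
  rw [cubeFunctional_eq_integral_cubeChange]
  -- split the variables `w ↔ (t, u')`
  set e := MeasurableEquiv.piEquivPiSubtypeProd (fun _ : Fin n ↦ ℝ) (IsRep (cyclePart σ)) with he
  have hev : MeasurePreserving e volume volume := volume_preserving_piEquivPiSubtypeProd _ _
  set F : (Fin n → ℝ) → ℂ := fun w ↦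
    if InBox σ (fun i : Free (cyclePart σ) ↦ w i) (fun r ↦ w r) then
      Φ (extG (cyclePart σ) (fun i : Free (cyclePart σ) ↦ w i)) else 0 with hF
  have hFe : ∀ z : ({j : Fin n // IsRep (cyclePart σ) j} → ℝ) × (Free (cyclePart σ) → ℝ),
      F (e.symm z) = if InBox σ z.2 z.1 then Φ (extG (cyclePart σ) z.2) else 0 := by
    rintro ⟨t, u'⟩
    have h1 : (fun i : Free (cyclePart σ) ↦ (e.symm (t, u')) i) = u' := by
      funext i
      simp [he, i.2]
    have h2 : (fun r : {j : Fin n // IsRep (cyclePart σ) j} ↦ (e.symm (t, u')) r) = t := by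
      funext r
      simp [he, r.2]
    simp only [hF, h1, h2]
  rw [← (hev.symm e).integral_comp' F]
  simp_rw [hFe]
  rw [Measure.volume_eq_prod, integral_prod_symm]
  · refine integral_congr_ae (Filter.Eventually.of_forall fun u' ↦ ?_)
    dsimp only
    exact integral_ite_inBox σ u' _
  · -- integrability on the product
    have hint := integrable_ite_inBox σ hΦ
    have := ((hev.symm e).integrable_comp_emb e.symm.measurableEmbedding (g := F)).2 hint
    rw [Measure.volume_eq_prod] at this
    refine this.congr (Filter.Eventually.of_forall fun z ↦ ?_)
    exact hFe z


/-! ## The interval lengths are `(1 - V)₊` with `V` the spread -/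

section spread

variable {r : Fin n} (hr : IsRep (cyclePart σ) r)
include hr

/-- The cycle sum `S_p = ∑_{i<p} u(σ^i r)` at the point `σ^p r` of the block. [folklore] -/
theorem cycSum_pow_apply (u : Fin n → ℝ) {p : ℕ} (hp : p < #((cyclePart σ).part r)) :
    cycSum σ u ((σ ^ p) r) = ∑ i ∈ range p, u ((σ ^ i) r) := by
  have hrep : rep (cyclePart σ) ((σ ^ p) r) = r := by rw [rep_pow_apply]; exact hr
  have hpos : pos σ ((σ ^ p) r) = p := by
    refine le_antisymm (pos_le_of_pow_eq σ (by rw [hrep])) ?_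
    by_contra hlt
    push Not at hlt
    have h1 := pow_pos_rep σ ((σ ^ p) r)
    rw [hrep] at h1
    have hmod := ((isCycleOn_part σ r).pow_apply_eq_pow_apply
      ((cyclePart σ).mem_part_self.2 (mem_univ r))).1 h1
    have hq : pos σ ((σ ^ p) r) < #((cyclePart σ).part r) := hlt.trans hp
    unfold Nat.ModEq at hmod
    rw [Nat.mod_eq_of_lt hq, Nat.mod_eq_of_lt hp] at hmod
    omega
  rw [cycSum, hrep, hpos]

omit hr in
/-- The block of `r` is `{σ^p r : p < ℓ}`. [folklore] -/
theorem image_pow_apply_range :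
    (range #((cyclePart σ).part r)).image (fun p ↦ (σ ^ p) r) = (cyclePart σ).part r := by
  have hrC : r ∈ (cyclePart σ).part r := (cyclePart σ).mem_part_self.2 (mem_univ r)
  refine Finset.eq_of_subset_of_card_le (fun j hj ↦ ?_) ?_
  · obtain ⟨p, -, rfl⟩ := Finset.mem_image.1 hj
    exact (pow_apply_eq_of_eqOn (σ := σ) (fun _ hx ↦ IsCycleOn.apply_mem' (isCycleOn_part σ r) hx)
      (fun _ _ ↦ rfl) p hrC).2
  · rw [Finset.card_image_of_injOn, Finset.card_range]
    intro p hp q hq hpq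
    have hmod := ((isCycleOn_part σ r).pow_apply_eq_pow_apply hrC).1 hpq
    unfold Nat.ModEq at hmod
    rw [Finset.mem_coe, Finset.mem_range] at hp hq
    rwa [Nat.mod_eq_of_lt hp, Nat.mod_eq_of_lt hq] at hmod

omit hr in
/-- The sum of `u` over the block of `r` is `S_ℓ`. [folklore] -/
theorem sum_range_card_eq_sum_part (u : Fin n → ℝ) :
    ∑ i ∈ range #((cyclePart σ).part r), u ((σ ^ i) r) = ∑ j ∈ (cyclePart σ).part r, u j := by
  have hrC : r ∈ (cyclePart σ).part r := (cyclePart σ).mem_part_self.2 (mem_univ r)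
  have hinj : ∀ p ∈ range #((cyclePart σ).part r), ∀ q ∈ range #((cyclePart σ).part r),
      (σ ^ p) r = (σ ^ q) r → p = q := by
    intro p hp q hq hpq
    have hmod := ((isCycleOn_part σ r).pow_apply_eq_pow_apply hrC).1 hpq
    unfold Nat.ModEq at hmod
    rw [Finset.mem_range] at hp hq
    rwa [Nat.mod_eq_of_lt hp, Nat.mod_eq_of_lt hq] at hmod
  calc ∑ i ∈ range #((cyclePart σ).part r), u ((σ ^ i) r)
      = ∑ j ∈ (range #((cyclePart σ).part r)).image (fun p ↦ (σ ^ p) r), u j :=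
        (Finset.sum_image hinj).symm
    _ = ∑ j ∈ (cyclePart σ).part r, u j := by rw [image_pow_apply_range σ]

/-- The maximum of the cycle sums over the block is `max_{p<ℓ} S_p`. [folklore] -/
theorem sup'_part_cycSum (u : Fin n → ℝ) :
    ((cyclePart σ).part r).sup' (part_nonempty σ r) (cycSum σ u) =
      (range #((cyclePart σ).part r)).sup' ⟨0, Finset.mem_range.2 (Finset.card_pos.2 (part_nonempty σ r))⟩
        (fun p ↦ ∑ i ∈ range p, u ((σ ^ i) r)) := by
  have himg := image_pow_apply_range σ (r := r)
  rw [Finset.sup'_congr _ himg.symm (fun _ _ ↦ rfl), Finset.sup'_image]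
  refine Finset.sup'_congr _ rfl fun p hp ↦ ?_
  exact cycSum_pow_apply σ hr u (Finset.mem_range.1 hp)

/-- The minimum of the cycle sums over the block is `min_{p<ℓ} S_p`. [folklore] -/
theorem inf'_part_cycSum (u : Fin n → ℝ) :
    ((cyclePart σ).part r).inf' (part_nonempty σ r) (cycSum σ u) =
      (range #((cyclePart σ).part r)).inf' ⟨0, Finset.mem_range.2 (Finset.card_pos.2 (part_nonempty σ r))⟩
        (fun p ↦ ∑ i ∈ range p, u ((σ ^ i) r)) := by
  have himg := image_pow_apply_range σ (r := r)
  rw [Finset.inf'_congr _ himg.symm (fun _ _ ↦ rfl), Finset.inf'_image]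
  refine Finset.inf'_congr _ rfl fun p hp ↦ ?_
  exact cycSum_pow_apply σ hr u (Finset.mem_range.1 hp)

omit hr in
/-- Prefix sums of the orbit sequence from `σ⁻¹ r` are the cycle sums `S_p`. [folklore] -/
theorem preSum_orbitSeq (u : Fin n → ℝ) (ℓ : ℕ) {p : ℕ} (hp : p ≤ ℓ) :
    preSum (u ∘ orbitSeq σ (σ⁻¹ r) ℓ) p = ∑ i ∈ range p, u ((σ ^ i) r) := by
  unfold preSum
  have horb : ∀ t : Fin ℓ, (u ∘ orbitSeq σ (σ⁻¹ r) ℓ) t = u ((σ ^ (t : ℕ)) r) := by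
    intro t
    simp only [Function.comp_apply, orbitSeq]
    rw [pow_succ, Perm.mul_apply]
    simp
  simp_rw [horb]
  rw [Finset.sum_filter, ← Finset.sum_range (fun i ↦ if i < p then u ((σ ^ i) r) else 0),
    ← Finset.sum_filter]
  congr 1
  ext i
  simp only [Finset.mem_filter, Finset.mem_range]
  omega

omit hr in
/-- `max_{p ≤ ℓ} S_p = max_{p < ℓ} S_p` when `S_ℓ = S_0 = 0`. [folklore] -/
theorem sup'_range_succ_eq {S : ℕ → ℝ} {ℓ : ℕ} (hℓ : 0 < ℓ) (hS : S ℓ = S 0) :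
    (range (ℓ + 1)).sup' ⟨0, by simp⟩ S = (range ℓ).sup' ⟨0, Finset.mem_range.2 hℓ⟩ S := by
  refine le_antisymm ?_ (Finset.sup'_mono S (Finset.range_subset_range.2 (Nat.le_succ ℓ)) _)
  refine Finset.sup'_le _ _ fun p hp ↦ ?_
  rcases Nat.lt_or_ge p ℓ with h | h
  · exact Finset.le_sup' S (Finset.mem_range.2 h)
  · have : p = ℓ := by rw [Finset.mem_range] at hp; omega
    rw [this, hS]
    exact Finset.le_sup' S (Finset.mem_range.2 hℓ)

omit hr in
/-- `min_{p ≤ ℓ} S_p = min_{p < ℓ} S_p` when `S_ℓ = S_0`. [folklore] -/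
theorem inf'_range_succ_eq {S : ℕ → ℝ} {ℓ : ℕ} (hℓ : 0 < ℓ) (hS : S ℓ = S 0) :
    (range (ℓ + 1)).inf' ⟨0, by simp⟩ S = (range ℓ).inf' ⟨0, Finset.mem_range.2 hℓ⟩ S := by
  refine le_antisymm (Finset.inf'_mono S (Finset.range_subset_range.2 (Nat.le_succ ℓ)) _) ?_
  refine Finset.le_inf' _ _ fun p hp ↦ ?_
  rcases Nat.lt_or_ge p ℓ with h | h
  · exact Finset.inf'_le S (Finset.mem_range.2 h)
  · have : p = ℓ := by rw [Finset.mem_range] at hp; omega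
    rw [this, hS]
    exact Finset.inf'_le S (Finset.mem_range.2 hℓ)

omit hr in
/-- `max_t (-s_t) = -min_t s_t`. [folklore] -/
theorem maxPre_neg_eq {ℓ : ℕ} (y : Fin ℓ → ℝ) :
    maxPre (-y) = -(range (ℓ + 1)).inf' ⟨0, by simp⟩ (preSum y) := by
  have hneg : ∀ t, preSum (-y) t = -preSum y t := fun t ↦ by simp [preSum, Finset.sum_neg_distrib]
  unfold maxPre
  refine le_antisymm ?_ ?_
  · refine Finset.sup'_le _ _ fun t ht ↦ ?_
    rw [hneg, neg_le_neg_iff]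
    exact Finset.inf'_le _ ht
  · obtain ⟨t, ht, heq⟩ := Finset.exists_mem_eq_inf' (s := range (ℓ + 1)) ⟨0, by simp⟩ (preSum y)
    rw [heq, ← hneg]
    exact Finset.le_sup' _ ht

/-- **The interval length is `(1 - V)₊`** with `V = V_{σ, C}(u)` the spread of `u` along the cycle
(RS Lemma 4.3), for `u` summing to zero on the block. [cite: RudnickSarnak1996, Lemma 4.3] -/
theorem boxLen_eq (u : Fin n → ℝ) (hu : ∑ j ∈ (cyclePart σ).part r, u j = 0) :
    boxLen σ u r = max (1 - cycSpread σ (σ⁻¹ r) #((cyclePart σ).part r) u) 0 := by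
  set ℓ := #((cyclePart σ).part r) with hℓ
  have hℓpos : 0 < ℓ := Finset.card_pos.2 (part_nonempty σ r)
  set S : ℕ → ℝ := fun p ↦ ∑ i ∈ range p, u ((σ ^ i) r) with hSdef
  have hS : S ℓ = S 0 := by
    simp only [hSdef, Finset.range_zero, Finset.sum_empty]
    rw [sum_range_card_eq_sum_part σ, hu]
  have hpre : ∀ p ∈ range (ℓ + 1), preSum (u ∘ orbitSeq σ (σ⁻¹ r) ℓ) p = S p := fun p hp ↦
    preSum_orbitSeq σ u ℓ (by rw [Finset.mem_range] at hp; omega)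
  have hmax : maxPre (u ∘ orbitSeq σ (σ⁻¹ r) ℓ) = (range ℓ).sup' ⟨0, Finset.mem_range.2 hℓpos⟩ S := by
    unfold maxPre
    rw [Finset.sup'_congr _ rfl hpre, sup'_range_succ_eq hℓpos hS]
  have hmin : maxPre (-(u ∘ orbitSeq σ (σ⁻¹ r) ℓ)) = -(range ℓ).inf' ⟨0, Finset.mem_range.2 hℓpos⟩ S := by
    rw [maxPre_neg_eq, Finset.inf'_congr _ rfl hpre, inf'_range_succ_eq hℓpos hS]
  rw [boxLen, cycSpread, spreadFn, hmax, hmin, sup'_part_cycSum σ hr, inf'_part_cycSum σ hr]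
  simp only [← hℓ, ← hSdef]
  ring_nf

end spread

/-! ## The theorem -/

/-- The cycle factor `(1 - V_{σ,C}(u))₊` of a block `C` (`1` for the empty set, which is not a
block), with the spread read from the base point `σ⁻¹(min C)` so that the ordering of the
block is `(min C, σ(min C), …)`. [cite: RudnickSarnak1996, Lemma 4.3] -/
def blockFactor (u : Fin n → ℝ) (C : Finset (Fin n)) : ℝ :=
  if h : C.Nonempty then max (1 - cycSpread σ (σ⁻¹ (C.min' h)) #C u) 0 else 1

/-- Products over the representatives are products over the blocks. [folklore] -/
theorem prod_subtype_isRep_eq_prod_parts {M : Type*} [CommMonoid M] (G : Finpartition (univ : Finset (Fin n)))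
    (g : Finset (Fin n) → M) :
    ∏ r : {j : Fin n // IsRep G j}, g (G.part r) = ∏ C ∈ G.parts, g C := by
  refine Finset.prod_bij (fun r _ ↦ G.part r) (fun r _ ↦ G.part_mem.2 (mem_univ _)) ?_ ?_ (fun _ _ ↦ rfl)
  · intro r₁ _ r₂ _ h
    apply Subtype.ext
    have h1 : rep G (r₁ : Fin n) = rep G (r₂ : Fin n) := by
      unfold rep
      congr 1
    rw [r₁.2, r₂.2] at h1
    exact h1
  · intro C hC
    obtain ⟨a, ha⟩ := G.nonempty_of_mem_parts hC
    refine ⟨⟨rep G a, isRep_rep G a⟩, mem_univ _, ?_⟩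
    rw [part_rep]
    exact G.part_eq_of_mem hC ha

/-- **The cube functional over the stratum** (RS Lemma 4.2 with Lemma 4.3): for continuous `Φ`,
`I_σ(Φ) = ∫_{[-1/2,1/2]ⁿ} Φ(s ∘ σ - s) ds = ∫ (∏_{C ∈ G} (1 - V_{σ,C}(u))₊) Φ(u) du`, the
integral over `u = extG G u' ∈ H_G` (`G` the orbit partition of `σ`, `u'` the free
coordinates with Lebesgue measure) and `V_{σ,C}` the spread of the partial sums of `u` along
the cycle `C` (`cycSpread`). [cite: RudnickSarnak1996, Lemma 4.2 and Lemma 4.3] -/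
theorem cubeFunctional_eq_integral_extG {Φ : (Fin n → ℝ) → ℂ} (hΦ : Continuous Φ) :
    cubeFunctional σ Φ = ∫ u' : Free (cyclePart σ) → ℝ,
      ((∏ C ∈ (cyclePart σ).parts, blockFactor σ (extG (cyclePart σ) u') C : ℝ) : ℂ) *
        Φ (extG (cyclePart σ) u') := by
  rw [cubeFunctional_eq_integral_boxLen σ hΦ]
  refine integral_congr_ae (Filter.Eventually.of_forall fun u' ↦ ?_)
  dsimp only
  congr 2
  rw [← prod_subtype_isRep_eq_prod_parts (cyclePart σ) (blockFactor σ (extG (cyclePart σ) u'))]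
  refine Finset.prod_congr rfl fun r _ ↦ ?_
  rw [boxLen_eq σ r.2 _ (sum_part_extG _ u' r), blockFactor, dif_pos (part_nonempty σ r)]
  congr 3
  change σ⁻¹ (r : Fin n) = σ⁻¹ (rep (cyclePart σ) r)
  rw [r.2]

end RudnickSarnak

end Literature.NumberTheory.LFunctions

end
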